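import Mathlib
import Literature.NumberTheory.LFunctions.Zhang2022.AppendixB

/-!
# Zhang (2022) Appendix B, proof of Lemma 15.1: the Cauchy-formula evaluations of
# `(2πi)⁻¹∮ G(s)/(s(s − β)²) ds` on the three circles of the `μ = 2` computation, and `ζ` near `1`

Topic `Literature/NumberTheory/LFunctions/Zhang2022` (Landau–Siegel audit tree; verdict-neutral).
Y. Zhang, *Discrete mean estimates and the Landau–Siegel zero*, arXiv:2211.02515v1 (2022)
[Zhang2022LandauSiegel] — **an unrefereed manuscript under adjudication.** Cell siegel-zhang
(D-0069), DISCHARGE row D16 (Lemma 15.1), DAG nodes `Z22:§B.u009`–`Z22:§B.u011` [Z22 p.107, tex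
L5296–5309]: "the right side is equal to the sum of the residues of the integrand at `s = 0` and
`s = β₇` …; by direct calculation, the residue at `s = 0` is …; the residue at `s = β₇` is, by the
Cauchy integral formula, …".

Everything here is PROVED and generic (no manuscript object beyond the shape of the integrand):

* `cauchy_three_term` — the tree's `AppendixB.circleIntegral_appB` with the exponential `e^{sL}`
  replaced by an ARBITRARY `G` holomorphic on an open set containing the closed disc: for
  `0, β ∈ ball c R`, `β ≠ 0`,
  `(2πi)⁻¹∮_{C(c,R)} G(s)/(s(s−β)²) ds = G(0)/β² − G(β)/β² + G′(β)/β`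
  (partial fractions `1/(s(s−β)²) = β⁻²/s − β⁻²/(s−β) + β⁻¹/(s−β)²`, Cauchy's formula at `0`, at `β`,
  and for the derivative at `β`);
* `cauchy_pole_zero_only`, `cauchy_pole_beta_only` — the same integral over a circle containing ONLY
  `0` (value `G(0)/β²`) or ONLY `β` (value `−G(β)/β² + G′(β)/β`): the decomposition of the residue
  sum into the two small circles of `Typed.AppendixB.StepB_u010a`/`StepB_u011a`;
* `zeta1_near_one` — explicit-radius packaging of Mathlib's `riemannZeta₁` (`ζ(s) = (s−1)⁻¹ζ₁(s)`,
  `ζ₁` entire, `ζ₁(1) = 1`): some `δ > 0`, `K ≥ 0` with `|ζ₁(1+z) − 1| ≤ K|z|`, `|ζ₁′(1+z)| ≤ K`,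
  `ζ₁(1+z) ≠ 0` for `|z| ≤ δ` — what turns "`ζ(1+s)/ζ(1+s−β_j)`" into a holomorphic `G` near `0`.

Consumer: `AppendixBLemma151Circles` (the three circle values for the actual integrand `intB2`).
WHAT THIS IS NOT: the contour shift from `Re s = 1` to the circle ("in a way similar to the proof
of Lemma 8.1", `StepB_u009r`), or any claim about Theorems 1–2 / Landau–Siegel zeros.

## References

* Y. Zhang, arXiv:2211.02515v1 (2022), App. B p. 107. [cite: Zhang2022LandauSiegel, App. B p.107]
-/

noncomputable section

open Complex Real Metric Set Filter Topology Asymptotics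

namespace Literature.NumberTheory.LFunctions.Zhang2022.Skeleton

/-! ## Cauchy evaluations of `∮ G(s)/(s(s−β)²)` -/

section Cauchy

variable {G : ℂ → ℂ} {U : Set ℂ} {c β : ℂ} {R : ℝ}

/-- `∮_{C(c,R)} (s − w)⁻¹ G(s) ds = 0` if `w ∉ closedBall c R` and `G` is holomorphic near the closed
disc. [cite: Zhang2022LandauSiegel, App. B p.107] -/
theorem circleIntegral_sub_inv_mul_eq_zero (hU : IsOpen U) (hG : DifferentiableOn ℂ G U)
    (hcl : closedBall c R ⊆ U) (hR : 0 ≤ R) {w : ℂ} (hw : w ∉ closedBall c R) (n : ℕ) :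
    (∮ s in C(c, R), ((s - w) ^ n)⁻¹ * G s) = 0 := by
  refine Complex.circleIntegral_eq_zero_of_differentiable_on_off_countable hR countable_empty ?_ ?_
  · refine ContinuousOn.mul ?_ (hG.continuousOn.mono hcl)
    refine ContinuousOn.inv₀ (by fun_prop) fun s hs => pow_ne_zero _ ?_
    exact sub_ne_zero.mpr fun h => hw (h ▸ hs)
  · intro z hz
    have hzU : z ∈ U := hcl (ball_subset_closedBall hz.1)
    have hzw : z - w ≠ 0 := sub_ne_zero.mpr fun h => hw (h ▸ ball_subset_closedBall hz.1)
    exact ((differentiableAt_id.sub_const w).pow n |>.inv (pow_ne_zero _ hzw)).mul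
      (hG.differentiableAt (hU.mem_nhds hzU))

/-- **The three-term Cauchy evaluation** (the tree's `AppendixB.circleIntegral_appB` for a general
holomorphic `G`): if `G` is holomorphic on an open `U ⊇ closedBall c R` and `0, β ∈ ball c R`, `β ≠ 0`,
then `(2πi)⁻¹∮_{C(c,R)} G(s)/(s(s − β)²) ds = G(0)/β² − G(β)/β² + G′(β)/β`.
[cite: Zhang2022LandauSiegel, App. B p.107] -/
theorem cauchy_three_term (hU : IsOpen U) (hG : DifferentiableOn ℂ G U) (hcl : closedBall c R ⊆ U)
    (h0 : (0 : ℂ) ∈ ball c R) (hβ : β ∈ ball c R) (hβ0 : β ≠ 0) :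
    (2 * π * I)⁻¹ * (∮ s in C(c, R), G s / (s * (s - β) ^ 2))
      = G 0 / β ^ 2 - G β / β ^ 2 + deriv G β / β := by
  have hR : 0 < R := pos_of_mem_ball hβ
  set A : ℂ := (β ^ 2)⁻¹ with hA
  set B : ℂ := -(β ^ 2)⁻¹ with hB
  set C : ℂ := β⁻¹ with hC
  have hne0 : ∀ s ∈ sphere c R, s - 0 ≠ 0 := fun s hs h =>
    (sphere_disjoint_ball.ne_of_mem hs h0) (sub_eq_zero.mp h)
  have hneβ : ∀ s ∈ sphere c R, s - β ≠ 0 := fun s hs h =>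
    (sphere_disjoint_ball.ne_of_mem hs hβ) (sub_eq_zero.mp h)
  have hcongr : EqOn (fun s => G s / (s * (s - β) ^ 2))
      (fun s => A * ((s - 0)⁻¹ * G s) + (B * ((s - β)⁻¹ * G s)
        + C * (((s - β) ^ 2)⁻¹ * G s))) (sphere c R) := by
    intro s hs
    have h1 := hne0 s hs
    have h2 := hneβ s hs
    rw [sub_zero] at h1
    simp only [hA, hB, hC, sub_zero]
    field_simp
    ring
  rw [circleIntegral.integral_congr hR.le hcongr]
  have hGc : ContinuousOn G (sphere c R) := hG.continuousOn.mono (sphere_subset_closedBall.trans hcl)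
  have hc0 : ContinuousOn (fun s : ℂ => (s - 0)⁻¹) (sphere c R) :=
    (continuousOn_id.sub continuousOn_const).inv₀ hne0
  have hc1 : ContinuousOn (fun s : ℂ => (s - β)⁻¹) (sphere c R) :=
    (continuousOn_id.sub continuousOn_const).inv₀ hneβ
  have hc2 : ContinuousOn (fun s : ℂ => ((s - β) ^ 2)⁻¹) (sphere c R) :=
    ((continuousOn_id.sub continuousOn_const).pow 2).inv₀ (fun s hs => pow_ne_zero 2 (hneβ s hs))
  have hi0 : CircleIntegrable (fun s => A * ((s - 0)⁻¹ * G s)) c R :=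
    (continuousOn_const.mul (hc0.mul hGc)).circleIntegrable hR.le
  have hi1 : CircleIntegrable (fun s => B * ((s - β)⁻¹ * G s)) c R :=
    (continuousOn_const.mul (hc1.mul hGc)).circleIntegrable hR.le
  have hi2 : CircleIntegrable (fun s => C * (((s - β) ^ 2)⁻¹ * G s)) c R :=
    (continuousOn_const.mul (hc2.mul hGc)).circleIntegrable hR.le
  have hi12 : CircleIntegrable (fun s => B * ((s - β)⁻¹ * G s)
      + C * (((s - β) ^ 2)⁻¹ * G s)) c R := hi1.add hi2
  rw [circleIntegral.integral_add hi0 hi12, circleIntegral.integral_add hi1 hi2,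
    circleIntegral.integral_const_mul, circleIntegral.integral_const_mul,
    circleIntegral.integral_const_mul]
  have hdc : DiffContOnCl ℂ G (ball c R) := hG.diffContOnCl_ball hcl
  have hv0 : (2 * π * I)⁻¹ * (∮ s in C(c, R), (s - 0)⁻¹ * G s) = G 0 := by
    have := hdc.two_pi_i_inv_smul_circleIntegral_sub_inv_smul h0
    simpa only [smul_eq_mul] using this
  have hv1 : (2 * π * I)⁻¹ * (∮ s in C(c, R), (s - β)⁻¹ * G s) = G β := by
    have := hdc.two_pi_i_inv_smul_circleIntegral_sub_inv_smul hβ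
    simpa only [smul_eq_mul] using this
  have hv2 : (2 * π * I)⁻¹ * (∮ s in C(c, R), ((s - β) ^ 2)⁻¹ * G s) = deriv G β := by
    have := Complex.two_pi_I_inv_smul_circleIntegral_sub_sq_inv_smul_of_differentiable
      hU hcl hG hβ
    simpa only [smul_eq_mul] using this
  calc (2 * π * I)⁻¹ * (A * (∮ s in C(c, R), (s - 0)⁻¹ * G s)
          + (B * (∮ s in C(c, R), (s - β)⁻¹ * G s) + C * ∮ s in C(c, R), ((s - β) ^ 2)⁻¹ * G s))
      = A * G 0 + B * G β + C * deriv G β := by rw [← hv0, ← hv1, ← hv2]; ring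
    _ = G 0 / β ^ 2 - G β / β ^ 2 + deriv G β / β := by
        simp only [hA, hB, hC]; field_simp; ring

/-- **Only the pole at `0` inside**: if `0 ∈ ball c R` but `β ∉ closedBall c R` (`β ≠ 0`), then
`(2πi)⁻¹∮_{C(c,R)} G(s)/(s(s − β)²) ds = G(0)/β²` (the residue at `s = 0`).
[cite: Zhang2022LandauSiegel, App. B p.107] -/
theorem cauchy_pole_zero_only (hU : IsOpen U) (hG : DifferentiableOn ℂ G U) (hcl : closedBall c R ⊆ U)
    (h0 : (0 : ℂ) ∈ ball c R) (hβ : β ∉ closedBall c R) (hβ0 : β ≠ 0) :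
    (2 * π * I)⁻¹ * (∮ s in C(c, R), G s / (s * (s - β) ^ 2)) = G 0 / β ^ 2 := by
  have hR : 0 < R := pos_of_mem_ball h0
  set A : ℂ := (β ^ 2)⁻¹ with hA
  set B : ℂ := -(β ^ 2)⁻¹ with hB
  set C : ℂ := β⁻¹ with hC
  have hne0 : ∀ s ∈ sphere c R, s - 0 ≠ 0 := fun s hs h =>
    (sphere_disjoint_ball.ne_of_mem hs h0) (sub_eq_zero.mp h)
  have hneβ : ∀ s ∈ sphere c R, s - β ≠ 0 := fun s hs h =>
    hβ (sphere_subset_closedBall ((sub_eq_zero.mp h) ▸ hs))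
  have hcongr : EqOn (fun s => G s / (s * (s - β) ^ 2))
      (fun s => A * ((s - 0)⁻¹ * G s) + (B * (((s - β) ^ 1)⁻¹ * G s)
        + C * (((s - β) ^ 2)⁻¹ * G s))) (sphere c R) := by
    intro s hs
    have h1 := hne0 s hs
    have h2 := hneβ s hs
    rw [sub_zero] at h1
    simp only [hA, hB, hC, sub_zero, pow_one]
    field_simp
    ring
  rw [circleIntegral.integral_congr hR.le hcongr]
  have hGc : ContinuousOn G (sphere c R) := hG.continuousOn.mono (sphere_subset_closedBall.trans hcl)
  have hc0 : ContinuousOn (fun s : ℂ => (s - 0)⁻¹) (sphere c R) :=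
    (continuousOn_id.sub continuousOn_const).inv₀ hne0
  have hc1 : ContinuousOn (fun s : ℂ => ((s - β) ^ 1)⁻¹) (sphere c R) :=
    ((continuousOn_id.sub continuousOn_const).pow 1).inv₀ (fun s hs => pow_ne_zero 1 (hneβ s hs))
  have hc2 : ContinuousOn (fun s : ℂ => ((s - β) ^ 2)⁻¹) (sphere c R) :=
    ((continuousOn_id.sub continuousOn_const).pow 2).inv₀ (fun s hs => pow_ne_zero 2 (hneβ s hs))
  have hi0 : CircleIntegrable (fun s => A * ((s - 0)⁻¹ * G s)) c R :=
    (continuousOn_const.mul (hc0.mul hGc)).circleIntegrable hR.le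
  have hi1 : CircleIntegrable (fun s => B * (((s - β) ^ 1)⁻¹ * G s)) c R :=
    (continuousOn_const.mul (hc1.mul hGc)).circleIntegrable hR.le
  have hi2 : CircleIntegrable (fun s => C * (((s - β) ^ 2)⁻¹ * G s)) c R :=
    (continuousOn_const.mul (hc2.mul hGc)).circleIntegrable hR.le
  have hi12 : CircleIntegrable (fun s => B * (((s - β) ^ 1)⁻¹ * G s)
      + C * (((s - β) ^ 2)⁻¹ * G s)) c R := hi1.add hi2
  rw [circleIntegral.integral_add hi0 hi12, circleIntegral.integral_add hi1 hi2,
    circleIntegral.integral_const_mul, circleIntegral.integral_const_mul,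
    circleIntegral.integral_const_mul,
    circleIntegral_sub_inv_mul_eq_zero hU hG hcl hR.le hβ 1,
    circleIntegral_sub_inv_mul_eq_zero hU hG hcl hR.le hβ 2]
  have hdc : DiffContOnCl ℂ G (ball c R) := hG.diffContOnCl_ball hcl
  have hv0 : (2 * π * I)⁻¹ * (∮ s in C(c, R), (s - 0)⁻¹ * G s) = G 0 := by
    have := hdc.two_pi_i_inv_smul_circleIntegral_sub_inv_smul h0
    simpa only [smul_eq_mul] using this
  calc (2 * π * I)⁻¹ * (A * (∮ s in C(c, R), (s - 0)⁻¹ * G s) + (B * 0 + C * 0))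
      = A * G 0 := by rw [← hv0]; ring
    _ = G 0 / β ^ 2 := by simp only [hA]; field_simp

/-- **Only the pole at `β` inside**: if `β ∈ ball c R` but `0 ∉ closedBall c R`, then
`(2πi)⁻¹∮_{C(c,R)} G(s)/(s(s − β)²) ds = −G(β)/β² + G′(β)/β` (the residue at the double pole).
[cite: Zhang2022LandauSiegel, App. B p.107] -/
theorem cauchy_pole_beta_only (hU : IsOpen U) (hG : DifferentiableOn ℂ G U) (hcl : closedBall c R ⊆ U)
    (h0 : (0 : ℂ) ∉ closedBall c R) (hβ : β ∈ ball c R) :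
    (2 * π * I)⁻¹ * (∮ s in C(c, R), G s / (s * (s - β) ^ 2)) = -(G β / β ^ 2) + deriv G β / β := by
  have hR : 0 < R := pos_of_mem_ball hβ
  have hβ0 : β ≠ 0 := fun h => h0 (ball_subset_closedBall (h ▸ hβ))
  set A : ℂ := (β ^ 2)⁻¹ with hA
  set B : ℂ := -(β ^ 2)⁻¹ with hB
  set C : ℂ := β⁻¹ with hC
  have hne0 : ∀ s ∈ sphere c R, s - 0 ≠ 0 := fun s hs h =>
    h0 (sphere_subset_closedBall ((sub_eq_zero.mp h) ▸ hs))
  have hneβ : ∀ s ∈ sphere c R, s - β ≠ 0 := fun s hs h =>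
    (sphere_disjoint_ball.ne_of_mem hs hβ) (sub_eq_zero.mp h)
  have hcongr : EqOn (fun s => G s / (s * (s - β) ^ 2))
      (fun s => A * (((s - 0) ^ 1)⁻¹ * G s) + (B * ((s - β)⁻¹ * G s)
        + C * (((s - β) ^ 2)⁻¹ * G s))) (sphere c R) := by
    intro s hs
    have h1 := hne0 s hs
    have h2 := hneβ s hs
    rw [sub_zero] at h1
    simp only [hA, hB, hC, sub_zero, pow_one]
    field_simp
    ring
  rw [circleIntegral.integral_congr hR.le hcongr]
  have hGc : ContinuousOn G (sphere c R) := hG.continuousOn.mono (sphere_subset_closedBall.trans hcl)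
  have hc0 : ContinuousOn (fun s : ℂ => ((s - 0) ^ 1)⁻¹) (sphere c R) :=
    ((continuousOn_id.sub continuousOn_const).pow 1).inv₀ (fun s hs => pow_ne_zero 1 (hne0 s hs))
  have hc1 : ContinuousOn (fun s : ℂ => (s - β)⁻¹) (sphere c R) :=
    (continuousOn_id.sub continuousOn_const).inv₀ hneβ
  have hc2 : ContinuousOn (fun s : ℂ => ((s - β) ^ 2)⁻¹) (sphere c R) :=
    ((continuousOn_id.sub continuousOn_const).pow 2).inv₀ (fun s hs => pow_ne_zero 2 (hneβ s hs))
  have hi0 : CircleIntegrable (fun s => A * (((s - 0) ^ 1)⁻¹ * G s)) c R :=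
    (continuousOn_const.mul (hc0.mul hGc)).circleIntegrable hR.le
  have hi1 : CircleIntegrable (fun s => B * ((s - β)⁻¹ * G s)) c R :=
    (continuousOn_const.mul (hc1.mul hGc)).circleIntegrable hR.le
  have hi2 : CircleIntegrable (fun s => C * (((s - β) ^ 2)⁻¹ * G s)) c R :=
    (continuousOn_const.mul (hc2.mul hGc)).circleIntegrable hR.le
  have hi12 : CircleIntegrable (fun s => B * ((s - β)⁻¹ * G s)
      + C * (((s - β) ^ 2)⁻¹ * G s)) c R := hi1.add hi2
  rw [circleIntegral.integral_add hi0 hi12, circleIntegral.integral_add hi1 hi2,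
    circleIntegral.integral_const_mul, circleIntegral.integral_const_mul,
    circleIntegral.integral_const_mul,
    circleIntegral_sub_inv_mul_eq_zero hU hG hcl hR.le h0 1]
  have hdc : DiffContOnCl ℂ G (ball c R) := hG.diffContOnCl_ball hcl
  have hv1 : (2 * π * I)⁻¹ * (∮ s in C(c, R), (s - β)⁻¹ * G s) = G β := by
    have := hdc.two_pi_i_inv_smul_circleIntegral_sub_inv_smul hβ
    simpa only [smul_eq_mul] using this
  have hv2 : (2 * π * I)⁻¹ * (∮ s in C(c, R), ((s - β) ^ 2)⁻¹ * G s) = deriv G β := by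
    have := Complex.two_pi_I_inv_smul_circleIntegral_sub_sq_inv_smul_of_differentiable
      hU hcl hG hβ
    simpa only [smul_eq_mul] using this
  calc (2 * π * I)⁻¹ * (A * 0 + (B * (∮ s in C(c, R), (s - β)⁻¹ * G s)
        + C * ∮ s in C(c, R), ((s - β) ^ 2)⁻¹ * G s))
      = B * G β + C * deriv G β := by rw [← hv1, ← hv2]; ring
    _ = -(G β / β ^ 2) + deriv G β / β := by simp only [hB, hC]; field_simp

end Cauchy

/-! ## `ζ` near `1` with an explicit radius -/

section ZetaNearOne

/-- **`ζ₁` near `1`, quantitatively**: for Mathlib's entire `riemannZeta₁` (`ζ(s) = (s−1)⁻¹ζ₁(s)` for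
`s ≠ 1`, `ζ₁(1) = 1`) there are `δ > 0` and `K ≥ 0` with `|ζ₁(1+z) − 1| ≤ K|z|`, `|ζ₁′(1+z)| ≤ K`
and `ζ₁(1+z) ≠ 0` whenever `|z| ≤ δ` (differentiability of `ζ₁` at `1`, continuity of `ζ₁′`,
`ζ₁(1) ≠ 0`). This is what makes `ζ(1+s)/ζ(1+s−β_j)·s/(s−β_j)` holomorphic and `= 1 + O(α)` on the
circles of Appendix B. [cite: Zhang2022LandauSiegel, App. B p.107] -/
theorem zeta1_near_one : ∃ δ : ℝ, 0 < δ ∧ ∃ K : ℝ, 0 ≤ K ∧ ∀ z : ℂ, ‖z‖ ≤ δ →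
    ‖riemannZeta₁ (1 + z) - 1‖ ≤ K * ‖z‖ ∧ ‖deriv riemannZeta₁ (1 + z)‖ ≤ K ∧
      riemannZeta₁ (1 + z) ≠ 0 := by
  -- (1) differentiability at 1: `ζ₁ s − 1 = O(s − 1)`
  have hO := (differentiable_riemannZeta₁ (1 : ℂ)).isBigO_sub
  rw [riemannZeta₁_one] at hO
  obtain ⟨C, hC⟩ := hO.bound
  -- (2) continuity of `ζ₁′` at 1: bounded near 1
  have hcont : ContinuousAt (deriv riemannZeta₁) 1 :=
    differentiable_riemannZeta₁.deriv.continuous.continuousAt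
  have hbd : ∀ᶠ s in 𝓝 (1 : ℂ), ‖deriv riemannZeta₁ s‖ ≤ ‖deriv riemannZeta₁ 1‖ + 1 := by
    have := (Metric.tendsto_nhds.mp hcont) 1 one_pos
    refine this.mono fun s hs => ?_
    have := norm_sub_norm_le (deriv riemannZeta₁ s) (deriv riemannZeta₁ 1)
    rw [dist_eq_norm] at hs
    linarith
  -- (3) non-vanishing near 1
  have hne := riemannZeta₁_ne_zero_of_near_one
  obtain ⟨ε, hε, hball⟩ := Metric.eventually_nhds_iff.mp (hC.and (hbd.and hne))
  refine ⟨ε / 2, by positivity, max C (‖deriv riemannZeta₁ 1‖ + 1), by positivity, fun z hz => ?_⟩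
  have hd : dist (1 + z) 1 < ε := by
    rw [dist_eq_norm, add_sub_cancel_left]; linarith
  obtain ⟨h1, h2, h3⟩ := hball hd
  refine ⟨?_, h2.trans (le_max_right _ _), h3⟩
  rw [add_sub_cancel_left] at h1
  exact h1.trans (mul_le_mul_of_nonneg_right (le_max_left _ _) (norm_nonneg _))

end ZetaNearOne

end Literature.NumberTheory.LFunctions.Zhang2022.Skeleton
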